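import Literature.AlgebraicGeometry.Motives.HodgeTensorMorphisms
import Literature.AlgebraicGeometry.Motives.AbelianVarietyProduct
import Literature.AlgebraicGeometry.Motives.BettiRealization
import HarnessLib

/-!
# Hodge structures of abelian type are closed under tensor products

Family `hodge`, layer `Literature/AlgebraicGeometry/Motives`. THEOREMS plus the plumbing
definitions they need (morphisms of Hodge structures with bodies); no named fact is introduced
(net debt 0). Sequel of `Motives/HodgeStructureAbelianType` (the single-triple predicate
`HodgeStructure.IsOfAbelianType`: `H` is a direct summand, in `ℚ`-Hodge structures, of some
`(H¹(A(ℂ); ℚ)^{⊗ m})(c)`), `Motives/HodgeStructureAbelianTypeTensorPower` (`f ↦ f^{⊗ k}`, twists)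
and `Motives/HodgeTensorMorphisms` (`f ⊗ g`, `H^{⊗ a} ⊗ H^{⊗ b} ≅ H^{⊗ (a + b)}`).

Sources read verbatim. Y. André, *Pour une théorie inconditionnelle des motifs*, Publ. Math. IHÉS
83 (1996) [Andre1996Motifs] (held text `paper:doi-10-1007-bf02698643`, PDF p. 27 = printed p. 30),
§6.1: "Ces motifs sont aussi les objets de la catégorie tannakienne `ℳ(𝒜b)_𝒱` engendrée par les
`𝔥(A)` et les motifs d'Artin". B. Moonen, *Families of motives and the Mumford–Tate conjecture*
[Moonen2017FamiliesMotives] (held text `paper:doi-10-1007-s00032-017-0273-x`, p. 3), §2.1: "This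
category `HS_ℚ` is a neutral Tannakian category; in particular we have direct sums, tensor
products and duals". C. Voisin, *Hodge Theory and Complex Algebraic Geometry I* [VoisinHodgeI2002],
§7.3.2: for a holomorphic map `φ : X → Y` of compact Kähler manifolds "`φ^*` is a morphism of
Hodge structures". P. Deligne, *Théorie de Hodge II* [DeligneHodgeII1971], 1.1.12, 2.1.13–2.1.14.

A Tannakian subcategory is closed under `⊗`. For the single-triple predicate, two structures
`H`, `H'` of abelian type are presented through possibly DIFFERENT abelian varieties `A`, `A'`;
one first REBASES both to the product `A × A'` — `H¹(A)` is a direct summand of `H¹(A × A')` in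
`ℚ`-Hodge structures, through the pull-backs along the projection `A × A' → A` and the section
`a ↦ (a, 0)` — and then `(H¹^{⊗ m})(c) ⊗ (H¹^{⊗ m'})(c') ≅ (H¹^{⊗ (m + m')})(c + c')` for
`H¹ = H¹(A × A')`.

## What is proved

For complex abelian varieties `A`, `A'` (Hodge symmetric models `M`, `M'`; any Hodge symmetric
model `MB` of `A × A'`; the model-independence of `H^{p,q}` is the tree's theorem
`hodgePQ_independent_of_hodgeModel_holds`):
* `AbelianVariety.hodgeFstHom` / `hodgeSndHom` — `pr₁^* : Hᵏ(A) → Hᵏ(A × A')`,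
  `pr₂^* : Hᵏ(A') → Hᵏ(A × A')` as morphisms of Hodge structures (the tree's
  `HodgeModel.hodgeStructureHom`, Voisin I §7.3.2), and `hodgeInlHom` / `hodgeInrHom` — the
  pull-backs along the sections `(𝟙, 0) : A → A × A'`, `(0, 𝟙) : A' → A × A'`;
  `hodgeInlHom_hodgeFstHom_apply` / `hodgeInrHom_hodgeSndHom_apply` — `(𝟙, 0)^* ∘ pr₁^* = id`,
  `(0, 𝟙)^* ∘ pr₂^* = id` (functoriality of `Hᵏ(-(ℂ); ℚ)` on `(𝟙, 0) ≫ pr₁ = 𝟙`): **`Hᵏ(A)` and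
  `Hᵏ(A')` are direct summands of `Hᵏ(A × A')` in `ℚ`-Hodge structures**;
* `Hom.abelianTensorMap f m c hw` — a morphism `f : H¹(A) → H¹(A')` of the weight-one structures
  induces `(f^{⊗ m})(c) : (H¹(A)^{⊗ m})(c) → (H¹(A')^{⊗ m})(c)` (retracts preserved,
  `Hom.abelianTensorMap_retract`);
* `exists_retract_abelianTensor_prod_left` / `_right` — REBASE: a direct summand of
  `(H¹(A)^{⊗ m})(c)` (resp. `(H¹(A')^{⊗ m})(c)`) is a direct summand of `(H¹(A × A')^{⊗ m})(c)`;
* `exists_retract_abelianTensor_tensor` — through ONE abelian variety `B`: direct summands `H` of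
  `(H¹(B)^{⊗ m})(c)` and `H'` of `(H¹(B)^{⊗ m'})(c')` give the direct summand `H ⊗ H'` of
  `(H¹(B)^{⊗ (m + m')})(c + c')` (through `j ⊗ j'`, the twist identity
  `T(c) ⊗ T'(c') = (T ⊗ T')(c + c')` and the concatenation `H¹^{⊗ m} ⊗ H¹^{⊗ m'} ≅ H¹^{⊗ (m+m')}`);
* **`IsOfAbelianType.tensor`** — if `H` and `H'` are of abelian type then so is `H ⊗ H'`
  (`HodgeStructure.tensor`); instance `isOfAbelianType_hodgeStructure_tensor` — every
  `Hᵏ(A(ℂ); ℚ) ⊗ Hˡ(A'(ℂ); ℚ)` is of abelian type.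
-/

noncomputable section

open scoped TensorProduct
open CategoryTheory

namespace Literature.AlgebraicGeometry.Motives

open Literature.AlgebraicTopology.SingularHomology
open Literature.AlgebraicGeometry.HodgeTheory

/-! ### `Hᵏ(A)` is a direct summand of `Hᵏ(A × A')` in `ℚ`-Hodge structures -/

namespace AbelianVariety

variable (A A' : AbelianVariety ℂ) (hA : IsSmoothProjective A.dim A.X)
  (M : HodgeTheory.HodgeModel A.dim A.X) (hM : M.IsHodgeSymmetric)
  (hA' : IsSmoothProjective A'.dim A'.X) (M' : HodgeTheory.HodgeModel A'.dim A'.X)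
  (hM' : M'.IsHodgeSymmetric) (hB : IsSmoothProjective (A.prod A').dim (A.prod A').X)
  (MB : HodgeTheory.HodgeModel (A.prod A').dim (A.prod A').X) (hMB : MB.IsHodgeSymmetric)

/-- **`pr₁^* : Hᵏ(A(ℂ); ℚ) → Hᵏ((A × A')(ℂ); ℚ)` is a morphism of Hodge structures** (pull-back along
the first projection of the product abelian variety `A × A'`, the tree's `AbelianVariety.fst`;
Voisin I §7.3.2 "`φ^*` is a morphism of Hodge structures", the tree's
`HodgeModel.hodgeStructureHom` granted its theorem `hodgePQ_independent_of_hodgeModel_holds`).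
[cite: VoisinHodgeI2002, §7.3.2] -/
def hodgeFstHom (k : ℕ) : HodgeStructure.Hom (M.hodgeStructure hA hM k) (MB.hodgeStructure hB hMB k) :=
  M.hodgeStructureHom hA hodgePQ_independent_of_hodgeModel_holds hM MB hB hMB
    (AbelianVariety.fst A A').hom.hom.hom k

/-- **`pr₂^* : Hᵏ(A'(ℂ); ℚ) → Hᵏ((A × A')(ℂ); ℚ)` is a morphism of Hodge structures** (pull-back
along `AbelianVariety.snd`). [cite: VoisinHodgeI2002, §7.3.2] -/
def hodgeSndHom (k : ℕ) :
    HodgeStructure.Hom (M'.hodgeStructure hA' hM' k) (MB.hodgeStructure hB hMB k) :=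
  M'.hodgeStructureHom hA' hodgePQ_independent_of_hodgeModel_holds hM' MB hB hMB
    (AbelianVariety.snd A A').hom.hom.hom k

/-- **`(𝟙, 0)^* : Hᵏ((A × A')(ℂ); ℚ) → Hᵏ(A(ℂ); ℚ)` is a morphism of Hodge structures** (pull-back
along the section `a ↦ (a, 0)`, the homomorphism `AbelianVariety.prodLift (𝟙 A) 0`).
[cite: VoisinHodgeI2002, §7.3.2] -/
def hodgeInlHom (k : ℕ) : HodgeStructure.Hom (MB.hodgeStructure hB hMB k) (M.hodgeStructure hA hM k) :=
  MB.hodgeStructureHom hB hodgePQ_independent_of_hodgeModel_holds hMB M hA hM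
    (AbelianVariety.prodLift (𝟙 A) (0 : A ⟶ A')).hom.hom.hom k

/-- **`(0, 𝟙)^* : Hᵏ((A × A')(ℂ); ℚ) → Hᵏ(A'(ℂ); ℚ)` is a morphism of Hodge structures** (pull-back
along the section `a' ↦ (0, a')`, `AbelianVariety.prodLift 0 (𝟙 A')`).
[cite: VoisinHodgeI2002, §7.3.2] -/
def hodgeInrHom (k : ℕ) :
    HodgeStructure.Hom (MB.hodgeStructure hB hMB k) (M'.hodgeStructure hA' hM' k) :=
  MB.hodgeStructureHom hB hodgePQ_independent_of_hodgeModel_holds hMB M' hA' hM'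
    (AbelianVariety.prodLift (0 : A' ⟶ A) (𝟙 A')).hom.hom.hom k

/-- The underlying map of `hodgeFstHom` is `pr₁(ℂ)^*` on `Hᵏ(-(ℂ); ℚ)` (`bettiCohomology.map`).
[cite: VoisinHodgeI2002, §7.3.2] -/
@[simp]
theorem hodgeFstHom_toLinearMap (k : ℕ) :
    (hodgeFstHom A A' hA M hM hB MB hMB k).toLinearMap =
      (bettiCohomology.map (AbelianVariety.fst A A').hom.hom.hom k).hom :=
  rfl

/-- The underlying map of `hodgeSndHom` is `pr₂(ℂ)^*`. [cite: VoisinHodgeI2002, §7.3.2] -/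
@[simp]
theorem hodgeSndHom_toLinearMap (k : ℕ) :
    (hodgeSndHom A A' hA' M' hM' hB MB hMB k).toLinearMap =
      (bettiCohomology.map (AbelianVariety.snd A A').hom.hom.hom k).hom :=
  rfl

/-- The underlying map of `hodgeInlHom` is `(𝟙, 0)(ℂ)^*`. [cite: VoisinHodgeI2002, §7.3.2] -/
@[simp]
theorem hodgeInlHom_toLinearMap (k : ℕ) :
    (hodgeInlHom A A' hA M hM hB MB hMB k).toLinearMap =
      (bettiCohomology.map (AbelianVariety.prodLift (𝟙 A) (0 : A ⟶ A')).hom.hom.hom k).hom :=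
  rfl

/-- The underlying map of `hodgeInrHom` is `(0, 𝟙)(ℂ)^*`. [cite: VoisinHodgeI2002, §7.3.2] -/
@[simp]
theorem hodgeInrHom_toLinearMap (k : ℕ) :
    (hodgeInrHom A A' hA' M' hM' hB MB hMB k).toLinearMap =
      (bettiCohomology.map (AbelianVariety.prodLift (0 : A' ⟶ A) (𝟙 A')).hom.hom.hom k).hom :=
  rfl

variable {A A'} in
/-- Functoriality of `Hᵏ(-(ℂ); ℚ)` on homomorphisms of abelian varieties: if `s ≫ p = 𝟙` then
`s^* (p^* v) = v` (contravariance `(s ≫ p)^* = s^* ∘ p^*`, `𝟙^* = id`; the tree's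
`bettiCohomology.map_comp` / `map_id`). [cite: HatcherAT2002, §3.1 p. 198] -/
theorem bettiCohomology_map_hom_apply_of_comp_eq_id {T : AbelianVariety ℂ} (s : T ⟶ A.prod A')
    (p : A.prod A' ⟶ T) (h : s ≫ p = 𝟙 T) (k : ℕ) (v : bettiCohomology T.X k) :
    (bettiCohomology.map s.hom.hom.hom k).hom ((bettiCohomology.map p.hom.hom.hom k).hom v) = v := by
  rw [← LinearMap.comp_apply, ← ModuleCat.hom_comp, ← bettiCohomology.map_comp]
  change (bettiCohomology.map (s ≫ p).hom.hom.hom k).hom v = v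
  rw [h]
  change (bettiCohomology.map (𝟙 T.X) k).hom v = v
  rw [bettiCohomology.map_id]
  rfl

/-- **`(𝟙, 0)^* ∘ pr₁^* = id` on `Hᵏ(A(ℂ); ℚ)`**: `Hᵏ(A)` is a direct summand of `Hᵏ(A × A')` in
`ℚ`-Hodge structures (`(𝟙, 0) ≫ pr₁ = 𝟙`, the tree's `AbelianVariety.prodLift_fst`).
[cite: VoisinHodgeI2002, §7.3.2] [cite: HatcherAT2002, §3.1 p. 198] -/
theorem hodgeInlHom_hodgeFstHom_apply (k : ℕ)
    (v : singularCohomology ℚ ℚ (ComplexPoints A.X) k) :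
    (hodgeInlHom A A' hA M hM hB MB hMB k).toLinearMap
        ((hodgeFstHom A A' hA M hM hB MB hMB k).toLinearMap v) = v :=
  bettiCohomology_map_hom_apply_of_comp_eq_id _ _ (AbelianVariety.prodLift_fst _ _) k v

/-- **`(0, 𝟙)^* ∘ pr₂^* = id` on `Hᵏ(A'(ℂ); ℚ)`**: `Hᵏ(A')` is a direct summand of `Hᵏ(A × A')`
(`(0, 𝟙) ≫ pr₂ = 𝟙`, `AbelianVariety.prodLift_snd`). [cite: VoisinHodgeI2002, §7.3.2]
[cite: HatcherAT2002, §3.1 p. 198] -/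
theorem hodgeInrHom_hodgeSndHom_apply (k : ℕ)
    (v : singularCohomology ℚ ℚ (ComplexPoints A'.X) k) :
    (hodgeInrHom A A' hA' M' hM' hB MB hMB k).toLinearMap
        ((hodgeSndHom A A' hA' M' hM' hB MB hMB k).toLinearMap v) = v :=
  bettiCohomology_map_hom_apply_of_comp_eq_id _ _ (AbelianVariety.prodLift_snd _ _) k v

end AbelianVariety

namespace HodgeStructure

/-! ### `f ↦ (f^{⊗ m})(c)` on the abelian tensor targets -/

section AbelianTensorMap

variable {A A' : AbelianVariety ℂ} {hA : IsSmoothProjective A.dim A.X}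
  {M : HodgeTheory.HodgeModel A.dim A.X} {hM : M.IsHodgeSymmetric}
  {hA' : IsSmoothProjective A'.dim A'.X} {M' : HodgeTheory.HodgeModel A'.dim A'.X}
  {hM' : M'.IsHodgeSymmetric}

/-- **A morphism `f : H¹(A) → H¹(A')` of weight-one Hodge structures induces
`(f^{⊗ m})(c) : (H¹(A)^{⊗ m})(c) → (H¹(A')^{⊗ m})(c)`** on the abelian tensor targets (across the
weight transports `cast hw`): the twisted tensor power `(Hom.tensorPowerMap f m).tateTwist c`
re-typed along the definitional filtration identities (`Hom.congrF`). Deligne, Hodge II, 1.1.12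
and 2.1.14: `⊗` and `- ⊗ ℚ(c)` are functors. [cite: DeligneHodgeII1971, 1.1.12 and 2.1.14] -/
def Hom.abelianTensorMap (f : Hom (M.hodgeStructure hA hM 1) (M'.hodgeStructure hA' hM' 1))
    (m : ℕ) (c : ℤ) {w : ℤ} (hw : (m : ℤ) - 2 * c = w) :
    Hom ((abelianTensor A hA M hM m c).cast hw) ((abelianTensor A' hA' M' hM' m c).cast hw) :=
  haveI : HodgeTensorFacts.{0, 0} := hodgeTensorFacts_holds
  ((Hom.tensorPowerMap f m).tateTwist c).congrF (fun _ ↦ rfl) (fun _ ↦ rfl)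

/-- The underlying map of `(f^{⊗ m})(c)` is `⊗ (f, …, f)`. [cite: DeligneHodgeII1971, 1.1.12] -/
@[simp]
theorem Hom.abelianTensorMap_toLinearMap
    (f : Hom (M.hodgeStructure hA hM 1) (M'.hodgeStructure hA' hM' 1)) (m : ℕ) (c : ℤ) {w : ℤ}
    (hw : (m : ℤ) - 2 * c = w) :
    (Hom.abelianTensorMap f m c hw).toLinearMap = PiTensorProduct.map fun _ : Fin m ↦ f.toLinearMap :=
  rfl

/-- **Retracts pass to the abelian tensor targets**: if `g ∘ f = id` on `H¹(A)` then
`(g^{⊗ m})(c) ∘ (f^{⊗ m})(c) = id` (`Hom.tensorPowerMap_retract`). [cite: DeligneHodgeII1971, 1.1.12] -/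
theorem Hom.abelianTensorMap_retract
    (f : Hom (M.hodgeStructure hA hM 1) (M'.hodgeStructure hA' hM' 1))
    (g : Hom (M'.hodgeStructure hA' hM' 1) (M.hodgeStructure hA hM 1))
    (hfg : ∀ v, g.toLinearMap (f.toLinearMap v) = v) (m : ℕ) (c : ℤ) {w : ℤ}
    (hw : (m : ℤ) - 2 * c = w) (x : ⨂[ℚ]^m (singularCohomology ℚ ℚ (ComplexPoints A.X) 1)) :
    (Hom.abelianTensorMap g m c hw).toLinearMap ((Hom.abelianTensorMap f m c hw).toLinearMap x) =
      x :=
  haveI : HodgeTensorFacts.{0, 0} := hodgeTensorFacts_holds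
  Hom.tensorPowerMap_retract f g hfg m x

end AbelianTensorMap

/-! ### Rebase: direct summands of `(H¹(A)^{⊗ m})(c)` are direct summands of `(H¹(A × A')^{⊗ m})(c)` -/

section Rebase

universe u

variable {V : Type u} [AddCommGroup V] [Module ℚ V] {w : ℤ}
variable (A A' : AbelianVariety ℂ) (hA : IsSmoothProjective A.dim A.X)
  (M : HodgeTheory.HodgeModel A.dim A.X) (hM : M.IsHodgeSymmetric)
  (hA' : IsSmoothProjective A'.dim A'.X) (M' : HodgeTheory.HodgeModel A'.dim A'.X)
  (hM' : M'.IsHodgeSymmetric) (hB : IsSmoothProjective (A.prod A').dim (A.prod A').X)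
  (MB : HodgeTheory.HodgeModel (A.prod A').dim (A.prod A').X) (hMB : MB.IsHodgeSymmetric)

/-- **Rebase to the product, left factor**: a direct summand `H` of `(H¹(A)^{⊗ m})(c)` (through
`(j, r)`, `r ∘ j = id`) is a direct summand of `(H¹(A × A')^{⊗ m})(c)`, through
`((pr₁^*)^{⊗ m}(c) ∘ j, r ∘ ((𝟙, 0)^*)^{⊗ m}(c))`. André §6.1: `ℳ(𝒜b)` is generated by the `𝔥(A)`
as a Tannakian category (and `𝔥¹(A)` is a direct factor of `𝔥¹(A × A')`).
[cite: Andre1996Motifs, §6.1 (p. 30)] [cite: VoisinHodgeI2002, §7.3.2] -/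
theorem exists_retract_abelianTensor_prod_left {H : HodgeStructure V w} (m : ℕ) (c : ℤ)
    (hw : (m : ℤ) - 2 * c = w) (j : H.Hom ((abelianTensor A hA M hM m c).cast hw))
    (r : ((abelianTensor A hA M hM m c).cast hw).Hom H)
    (hjr : ∀ v, r.toLinearMap (j.toLinearMap v) = v) :
    ∃ (j₁ : H.Hom ((abelianTensor (A.prod A') hB MB hMB m c).cast hw))
      (r₁ : ((abelianTensor (A.prod A') hB MB hMB m c).cast hw).Hom H),
      ∀ v, r₁.toLinearMap (j₁.toLinearMap v) = v := by
  refine ⟨(Hom.abelianTensorMap (AbelianVariety.hodgeFstHom A A' hA M hM hB MB hMB 1) m c hw).comp j,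
    r.comp (Hom.abelianTensorMap (AbelianVariety.hodgeInlHom A A' hA M hM hB MB hMB 1) m c hw),
    fun v ↦ ?_⟩
  show r.toLinearMap ((Hom.abelianTensorMap (AbelianVariety.hodgeInlHom A A' hA M hM hB MB hMB 1)
    m c hw).toLinearMap ((Hom.abelianTensorMap (AbelianVariety.hodgeFstHom A A' hA M hM hB MB hMB 1)
      m c hw).toLinearMap (j.toLinearMap v))) = v
  rw [Hom.abelianTensorMap_retract _ _
    (AbelianVariety.hodgeInlHom_hodgeFstHom_apply A A' hA M hM hB MB hMB 1), hjr]

/-- **Rebase to the product, right factor**: a direct summand of `(H¹(A')^{⊗ m})(c)` is a direct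
summand of `(H¹(A × A')^{⊗ m})(c)` (through `pr₂^*` and `(0, 𝟙)^*`).
[cite: Andre1996Motifs, §6.1 (p. 30)] [cite: VoisinHodgeI2002, §7.3.2] -/
theorem exists_retract_abelianTensor_prod_right {H : HodgeStructure V w} (m : ℕ) (c : ℤ)
    (hw : (m : ℤ) - 2 * c = w) (j : H.Hom ((abelianTensor A' hA' M' hM' m c).cast hw))
    (r : ((abelianTensor A' hA' M' hM' m c).cast hw).Hom H)
    (hjr : ∀ v, r.toLinearMap (j.toLinearMap v) = v) :
    ∃ (j₁ : H.Hom ((abelianTensor (A.prod A') hB MB hMB m c).cast hw))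
      (r₁ : ((abelianTensor (A.prod A') hB MB hMB m c).cast hw).Hom H),
      ∀ v, r₁.toLinearMap (j₁.toLinearMap v) = v := by
  refine ⟨(Hom.abelianTensorMap (AbelianVariety.hodgeSndHom A A' hA' M' hM' hB MB hMB 1) m c hw).comp j,
    r.comp (Hom.abelianTensorMap (AbelianVariety.hodgeInrHom A A' hA' M' hM' hB MB hMB 1) m c hw),
    fun v ↦ ?_⟩
  show r.toLinearMap ((Hom.abelianTensorMap (AbelianVariety.hodgeInrHom A A' hA' M' hM' hB MB hMB 1)
    m c hw).toLinearMap ((Hom.abelianTensorMap (AbelianVariety.hodgeSndHom A A' hA' M' hM' hB MB hMB 1)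
      m c hw).toLinearMap (j.toLinearMap v))) = v
  rw [Hom.abelianTensorMap_retract _ _
    (AbelianVariety.hodgeInrHom_hodgeSndHom_apply A A' hA' M' hM' hB MB hMB 1), hjr]

end Rebase

/-! ### Tensor products of direct summands of the abelian tensor targets of ONE abelian variety -/

section OneVariety

universe u v

variable {V : Type u} [AddCommGroup V] [Module ℚ V] {V' : Type v} [AddCommGroup V'] [Module ℚ V']
  {w w' : ℤ}
variable (B : AbelianVariety ℂ) (hB : IsSmoothProjective B.dim B.X)
  (MB : HodgeTheory.HodgeModel B.dim B.X) (hMB : MB.IsHodgeSymmetric)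

/-- **Through one abelian variety, `⊗` of direct summands is a direct summand**: if `H` is a direct
summand of `(H¹(B)^{⊗ m})(c)` through `(j, r)` and `H'` of `(H¹(B)^{⊗ m'})(c')` through `(j', r')`,
then `H ⊗ H'` is a direct summand of `(H¹(B)^{⊗ (m + m')})(c + c')` through
`μ ∘ (j ⊗ j')` and `(r ⊗ r') ∘ μ⁻¹`, where `(H¹^{⊗ m})(c) ⊗ (H¹^{⊗ m'})(c') = (H¹^{⊗ m} ⊗ H¹^{⊗ m'})(c + c')`
(`tensorFiltration_tateTwist`, Hodge II 2.1.14) and `μ : H¹^{⊗ m} ⊗ H¹^{⊗ m'} ≅ H¹^{⊗ (m + m')}` is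
the concatenation isomorphism of Hodge structures (`Hom.tensorPowerMul`, Hodge II 1.1.12). Moonen
§2.1: tensor products in `HS_ℚ` are "given by the usual constructions".
[cite: Andre1996Motifs, §6.1 (p. 30)] [cite: Moonen2017FamiliesMotives, §2.1 (p. 3)]
[cite: DeligneHodgeII1971, 1.1.12 and 2.1.14] -/
theorem exists_retract_abelianTensor_tensor [HodgeTensorFacts.{u, v}] {H : HodgeStructure V w}
    {H' : HodgeStructure V' w'} (m : ℕ) (c : ℤ) (hw : (m : ℤ) - 2 * c = w)
    (j : H.Hom ((abelianTensor B hB MB hMB m c).cast hw))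
    (r : ((abelianTensor B hB MB hMB m c).cast hw).Hom H)
    (hjr : ∀ v, r.toLinearMap (j.toLinearMap v) = v) (m' : ℕ) (c' : ℤ)
    (hw' : (m' : ℤ) - 2 * c' = w') (j' : H'.Hom ((abelianTensor B hB MB hMB m' c').cast hw'))
    (r' : ((abelianTensor B hB MB hMB m' c').cast hw').Hom H')
    (hjr' : ∀ v, r'.toLinearMap (j'.toLinearMap v) = v) :
    ∃ (j₂ : (H.tensor H').Hom ((abelianTensor B hB MB hMB (m + m') (c + c')).cast
        (by rw [← hw, ← hw']; push_cast; ring)))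
      (r₂ : ((abelianTensor B hB MB hMB (m + m') (c + c')).cast
        (by rw [← hw, ← hw']; push_cast; ring)).Hom (H.tensor H')),
      ∀ z, r₂.toLinearMap (j₂.toLinearMap z) = z := by
  haveI : HodgeTensorFacts.{0, 0} := hodgeTensorFacts_holds
  -- `T(c) ⊗ T'(c') = (H₁^{⊗ m} ⊗ H₁^{⊗ m'})(c + c')` on the same space (`H₁ = H¹(B)`)
  have hF : ∀ p, (((abelianTensor B hB MB hMB m c).cast hw).tensor
      ((abelianTensor B hB MB hMB m' c').cast hw')).F p =
      ((((MB.hodgeStructure hB hMB 1).tensorPower m).tensor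
        ((MB.hodgeStructure hB hMB 1).tensorPower m')).tateTwist (c + c')).F p := by
    intro p
    show ((((MB.hodgeStructure hB hMB 1).tensorPower m).tateTwist c).cast (by push_cast; ring)
          |>.cast hw).tensorFiltration
        (((((MB.hodgeStructure hB hMB 1).tensorPower m').tateTwist c').cast (by push_cast; ring))
          |>.cast hw') p =
      ((MB.hodgeStructure hB hMB 1).tensorPower m).tensorFiltration
        ((MB.hodgeStructure hB hMB 1).tensorPower m') (p + (c + c'))
    rw [show p + (c + c') = p + c + c' by ring, ← tensorFiltration_tateTwist]
    rfl
  -- `μ(c + c') ∘ (j ⊗ j')` and `(r ⊗ r') ∘ μ⁻¹(c + c')`, `μ` the concatenation `Hom.tensorPowerMul`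
  have hw₂ : ((m + m' : ℕ) : ℤ) - 2 * (c + c') = w + w' := by rw [← hw, ← hw']; push_cast; ring
  have hL : (m : ℤ) * 1 + (m' : ℤ) * 1 - 2 * (c + c') = w + w' := by rw [← hw, ← hw']; ring
  let μ : (((((MB.hodgeStructure hB hMB 1).tensorPower m).tensor
        ((MB.hodgeStructure hB hMB 1).tensorPower m')).tateTwist (c + c')).cast hL).Hom
      ((abelianTensor B hB MB hMB (m + m') (c + c')).cast hw₂) :=
    ((Hom.tensorPowerMul (MB.hodgeStructure hB hMB 1) m m').tateTwist (c + c')).congrF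
      (fun _ ↦ rfl) (fun _ ↦ rfl)
  let μr : ((abelianTensor B hB MB hMB (m + m') (c + c')).cast hw₂).Hom
      (((((MB.hodgeStructure hB hMB 1).tensorPower m).tensor
        ((MB.hodgeStructure hB hMB 1).tensorPower m')).tateTwist (c + c')).cast hL) :=
    ((Hom.tensorPowerMulSymm (MB.hodgeStructure hB hMB 1) m m').tateTwist (c + c')).congrF
      (fun _ ↦ rfl) (fun _ ↦ rfl)
  let ι : (((abelianTensor B hB MB hMB m c).cast hw).tensor
        ((abelianTensor B hB MB hMB m' c').cast hw')).Hom
      (((((MB.hodgeStructure hB hMB 1).tensorPower m).tensor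
        ((MB.hodgeStructure hB hMB 1).tensorPower m')).tateTwist (c + c')).cast hL) :=
    Hom.ofEqF hF
  let ιr : (((((MB.hodgeStructure hB hMB 1).tensorPower m).tensor
        ((MB.hodgeStructure hB hMB 1).tensorPower m')).tateTwist (c + c')).cast hL).Hom
      (((abelianTensor B hB MB hMB m c).cast hw).tensor
        ((abelianTensor B hB MB hMB m' c').cast hw')) :=
    Hom.ofEqF fun p ↦ (hF p).symm
  -- (universe levels of `Hom.tensorMap` given explicitly: its instance arguments precede `f`, `g`,
  -- and the local `HodgeTensorFacts.{0, 0}` would otherwise be found first)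
  refine ⟨μ.comp (ι.comp (Hom.tensorMap.{u, 0, v, 0} j j')),
    (Hom.tensorMap.{0, u, 0, v} r r').comp (ιr.comp μr), fun z ↦ ?_⟩
  show (Hom.tensorMap.{0, u, 0, v} r r').toLinearMap
      ((Hom.tensorPowerMulSymm (MB.hodgeStructure hB hMB 1) m m').toLinearMap
        ((Hom.tensorPowerMul (MB.hodgeStructure hB hMB 1) m m').toLinearMap
          ((Hom.tensorMap.{u, 0, v, 0} j j').toLinearMap z))) = z
  rw [Hom.tensorPowerMulSymm_tensorPowerMul_apply,
    Hom.tensorMap_retract.{u, 0, v, 0} j r hjr j' r' hjr']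

end OneVariety

/-! ### Structures of abelian type are closed under tensor products -/

section AbelianType

universe u v

variable {V : Type u} [AddCommGroup V] [Module ℚ V] {V' : Type v} [AddCommGroup V'] [Module ℚ V']
  {w w' : ℤ}

/-- **Tensor products of Hodge structures of abelian type are of abelian type.** If `H` is a direct
summand of `(H¹(A)^{⊗ m})(c)` and `H'` of `(H¹(A')^{⊗ m'})(c')`, then both are direct summands of
the corresponding targets of the product abelian variety `A × A'` (rebase along `pr₁^*`, `pr₂^*`
with retractions `(𝟙, 0)^*`, `(0, 𝟙)^*`), and `H ⊗ H'` is a direct summand of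
`(H¹(A × A')^{⊗ (m + m')})(c + c')`. This is the stability of André's Tannakian category
`ℳ(𝒜b)` ("engendrée par les `𝔥(A)`", §6.1) under `⊗`, on the Hodge side (Moonen §2.1: `HS_ℚ` is
Tannakian, "in particular we have … tensor products"). The product `A × A'` is smooth projective
(`AbelianVariety.isSmoothProjective_holds`) and carries a Hodge symmetric model
(`exists_isReal_hodgeModel_holds`). [cite: Andre1996Motifs, §6.1 (p. 30)]
[cite: Moonen2017FamiliesMotives, §2.1 (p. 3)] [cite: DeligneHodgeII1971, 1.1.12 and 2.1.14] -/
theorem IsOfAbelianType.tensor [HodgeTensorFacts.{u, v}] {H : HodgeStructure V w}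
    {H' : HodgeStructure V' w'} (h : H.IsOfAbelianType) (h' : H'.IsOfAbelianType) :
    (H.tensor H').IsOfAbelianType := by
  obtain ⟨A, hA, M, hM, m, c, hw, j, r, hjr⟩ := h
  obtain ⟨A', hA', M', hM', m', c', hw', j', r', hjr'⟩ := h'
  have hB : IsSmoothProjective (A.prod A').dim (A.prod A').X :=
    AbelianVariety.isSmoothProjective_holds
  obtain ⟨MB, hMB⟩ := HodgeTheory.exists_isReal_hodgeModel_holds.exists_isHodgeSymmetric hB
  obtain ⟨j₁, r₁, hjr₁⟩ :=
    exists_retract_abelianTensor_prod_left A A' hA M hM hB MB hMB m c hw j r hjr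
  obtain ⟨j₁', r₁', hjr₁'⟩ :=
    exists_retract_abelianTensor_prod_right A A' hA' M' hM' hB MB hMB m' c' hw' j' r' hjr'
  obtain ⟨j₂, r₂, hjr₂⟩ := exists_retract_abelianTensor_tensor (A.prod A') hB MB hMB m c hw j₁ r₁
    hjr₁ m' c' hw' j₁' r₁' hjr₁'
  exact ⟨A.prod A', hB, MB, hMB, m + m', c + c', by rw [← hw, ← hw']; push_cast; ring, j₂, r₂, hjr₂⟩

section Instances

variable [HodgeTensorFacts.{0, 0}]

/-- **Every `Hᵏ(A(ℂ); ℚ) ⊗ Hˡ(A'(ℂ); ℚ)` of two complex abelian varieties is of abelian type**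
(`Hᵏ(A)` and `Hˡ(A')` are, `isOfAbelianType_hodgeStructure`; then `IsOfAbelianType.tensor`).
André §6.1: `ℳ(𝒜b)` is generated by the `𝔥(A)` as a Tannakian category.
[cite: Andre1996Motifs, §6.1 (p. 30)] -/
theorem isOfAbelianType_hodgeStructure_tensor (A A' : AbelianVariety ℂ)
    (hA : IsSmoothProjective A.dim A.X) (M : HodgeTheory.HodgeModel A.dim A.X)
    (hM : M.IsHodgeSymmetric) (hA' : IsSmoothProjective A'.dim A'.X)
    (M' : HodgeTheory.HodgeModel A'.dim A'.X) (hM' : M'.IsHodgeSymmetric) (k l : ℕ) :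
    ((M.hodgeStructure hA hM k).tensor (M'.hodgeStructure hA' hM' l)).IsOfAbelianType :=
  IsOfAbelianType.tensor (isOfAbelianType_hodgeStructure A hA M hM k)
    (isOfAbelianType_hodgeStructure A' hA' M' hM' l)

/-- Tensor products `((H¹(A)^{⊗ m})(c)) ⊗ ((H¹(A')^{⊗ m'})(c'))` of the generators are of abelian
type. [cite: Andre1996Motifs, §6.1 (p. 30)] -/
theorem isOfAbelianType_abelianTensor_tensor (A A' : AbelianVariety ℂ)
    (hA : IsSmoothProjective A.dim A.X) (M : HodgeTheory.HodgeModel A.dim A.X)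
    (hM : M.IsHodgeSymmetric) (hA' : IsSmoothProjective A'.dim A'.X)
    (M' : HodgeTheory.HodgeModel A'.dim A'.X) (hM' : M'.IsHodgeSymmetric) (m : ℕ) (c : ℤ)
    (m' : ℕ) (c' : ℤ) :
    ((abelianTensor A hA M hM m c).tensor (abelianTensor A' hA' M' hM' m' c')).IsOfAbelianType :=
  IsOfAbelianType.tensor (isOfAbelianType_abelianTensor A hA M hM m c)
    (isOfAbelianType_abelianTensor A' hA' M' hM' m' c')

end Instances

end AbelianType

end HodgeStructure

end Literature.AlgebraicGeometry.Motives
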